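import Summits.Ventures.WeilGRH.DualTrigKernelSoundD
import HarnessLib

/-!
# Format D-K soundness, part 7: unpacking the frame checks; coverage; the tail

Cell `rh-explicit`, WEIL TRACK — GRH ARM, route B (weil-grh-3).  Continuation of
`DualTrigKernelSoundD.lean`: the Boolean frame checks (`constsOK`, `blocksOK`, `cellsOK`, `tailOK`)
are unpacked into real statements; every `θ` of the covered range lies in a checked cell; the
periodic part is bounded below by `mT/S` everywhere; beyond the covered range the tail inequality
bounds the full function.  The final theorem is in `DualTrigKernelSound.lean`.

Everything here is PROVED; no named facts, no `sorry`.
-/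

noncomputable section

open Finset Real Complex

namespace Summit.Ventures.WeilGRH

open Literature.Analysis.ValidatedNumerics.NumericsMP
open DualTrigTaylor DigammaVertical

namespace DKCert

variable {c : DKCert}

/-! ### Constants -/

/-- The real `ρ = D/(2 log p₀)`. [folklore] -/
def rhoR (c : DKCert) : ℝ := (c.D : ℝ) / (2 * Real.log c.p0)

/-- The real constant `log q − log π`. [folklore] -/
def constR (c : DKCert) : ℝ := Real.log c.q - Real.log Real.pi

/-- Unpacking `constsOK`. [folklore] -/
theorem constsOK_sound (h : c.constsOK = true) :
    0 < c.S ∧ 2 ≤ c.p0 ∧ 1 ≤ c.D ∧ c.par ≤ 1 ∧ 1 ≤ c.R ∧ 0 < c.rhoI.lo ∧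
      MI.mem c.S Real.pi c.piI ∧ MI.mem c.S (Real.log c.p0) c.logp0I ∧
      MI.mem c.S c.rhoR c.rhoI ∧ MI.mem c.S c.constR c.constI := by
  unfold constsOK at h
  simp only [Bool.and_eq_true, decide_eq_true_eq] at h
  obtain ⟨⟨⟨⟨⟨⟨⟨⟨⟨⟨hS, hp0⟩, hD⟩, hpar⟩, hR⟩, hl0⟩, hpi0⟩, hrho0⟩, hpi⟩, hlog⟩, hconst⟩ := h
  have hpim : MI.mem c.S Real.pi c.piI := by
    cases hP : MI.piMachin c.S c.Kser with
    | none => simp [hP] at hpi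
    | some P => simp only [hP] at hpi; exact mem_of_encl hpi (MI.mem_piMachin hS hP)
  have hlogm : MI.mem c.S (Real.log c.p0) c.logp0I ∧ MI.mem c.S c.rhoR c.rhoI := by
    cases hL : MI.logNat c.S c.Kser c.p0 with
    | none => simp [hL] at hlog
    | some L =>
      simp only [hL, Bool.and_eq_true] at hlog
      have hLm := MI.mem_logNat hS hL
      refine ⟨mem_of_encl hlog.1 hLm, ?_⟩
      cases hRR : MI.divPos c.S (MI.ofInt c.S c.D) (L.mulInt 2) with
      | none => simp [hRR] at hlog
      | some RR =>
        have h2 := hlog.2; simp only [hRR] at h2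
        have := MI.mem_divPos hS hRR (MI.mem_ofInt c.S (c.D : ℤ)) (MI.mem_mulInt hLm 2)
        refine mem_of_encl h2 ?_
        have e : c.rhoR = ((c.D : ℤ) : ℝ) / (Real.log c.p0 * ((2 : ℤ) : ℝ)) := by
          unfold rhoR; push_cast; ring
        rw [e]; exact this
  have hconstm : MI.mem c.S c.constR c.constI := by
    cases hQ : MI.logNat c.S c.Kser c.q with
    | none => simp [hQ] at hconst
    | some Lq =>
      cases hP : MI.logPos c.S c.Kser c.piI with
      | none => simp [hQ, hP] at hconst
      | some Lp =>
        simp only [hQ, hP] at hconst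
        exact mem_of_encl hconst (MI.mem_sub (MI.mem_logNat hS hQ) (MI.mem_logPos hS hP hpim).2)
  exact ⟨hS, hp0, hD, hpar, hR, hrho0, hpim, hlogm.1, hlogm.2, hconstm⟩

/-- `ρ > 0` and `ρ ω = 1/2`. [folklore] -/
theorem rhoR_pos_and_mul (hp0 : 2 ≤ c.p0) (hD : 1 ≤ c.D) : 0 < c.rhoR ∧ c.rhoR * c.omegaR = 1 / 2 := by
  have hl : 0 < Real.log c.p0 := Real.log_pos (by exact_mod_cast hp0)
  have hDr : (0 : ℝ) < c.D := by exact_mod_cast hD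
  refine ⟨by unfold rhoR; positivity, ?_⟩
  unfold rhoR omegaR; field_simp

/-! ### The full real function -/

/-- The full function of the certificate in the variable `θ = ωτ`:
`Re ψ(σ' + iρθ) + (log q − log π) + Σ_t val_t(θ)`. [folklore] -/
def Pθ (c : DKCert) (θ : ℝ) : ℝ :=
  (Complex.digamma ((c.sigR : ℂ) + (c.rhoR * θ : ℝ) * I)).re + c.constR + sumVal c.termsR θ

/-! ### Cells of a block, blocks of the range -/

/-- The start `2π j0/Mc` of a block. [folklore] -/
def bStart (b : DKBlock) : ℝ := 2 * π * b.j0 / b.Mc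

/-- The end `2π (j0+n)/Mc` of a block. [folklore] -/
def bEnd (b : DKBlock) : ℝ := 2 * π * (b.j0 + b.n) / b.Mc

/-- A point of a block lies in one of its cells. [folklore] -/
theorem exists_cell {b : DKBlock} (hMc : 1 ≤ b.Mc) (hn : 1 ≤ b.n) {θ : ℝ} (h1 : bStart b ≤ θ) (h2 : θ ≤ bEnd b) :
    ∃ i : ℕ, i < b.n ∧ 2 * π * ((b.j0 + i : ℤ) : ℝ) / b.Mc ≤ θ ∧ θ ≤ 2 * π * (((b.j0 + i : ℤ) : ℝ) + 1) / b.Mc := by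
  have hMcr : (0 : ℝ) < b.Mc := by exact_mod_cast hMc
  have h2π : (0 : ℝ) < 2 * π := by positivity
  set u : ℝ := θ * b.Mc / (2 * π) - b.j0 with hu
  have hu0 : 0 ≤ u := by
    rw [hu, sub_nonneg, le_div_iff₀ h2π]; unfold bStart at h1
    rw [div_le_iff₀ hMcr] at h1; linarith
  have hun : u ≤ b.n := by
    rw [hu, sub_le_iff_le_add, div_le_iff₀ h2π]; unfold bEnd at h2
    rw [le_div_iff₀ hMcr] at h2; linarith
  set i : ℕ := min ⌊u⌋.toNat (b.n - 1) with hi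
  have hfl : 0 ≤ ⌊u⌋ := Int.floor_nonneg.2 hu0
  have hi_le : (i : ℝ) ≤ u := by
    have : (i : ℝ) ≤ ((⌊u⌋.toNat : ℕ) : ℝ) := by exact_mod_cast min_le_left _ _
    refine this.trans ?_
    rw [show ((⌊u⌋.toNat : ℕ) : ℝ) = ((⌊u⌋ : ℤ) : ℝ) by exact_mod_cast Int.toNat_of_nonneg hfl]
    exact Int.floor_le u
  have hi_ge : u ≤ i + 1 := by
    rcases le_total ⌊u⌋.toNat (b.n - 1) with hle | hle
    · rw [hi, min_eq_left hle]
      rw [show ((⌊u⌋.toNat : ℕ) : ℝ) = ((⌊u⌋ : ℤ) : ℝ) by exact_mod_cast Int.toNat_of_nonneg hfl]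
      exact (Int.lt_floor_add_one u).le
    · rw [hi, min_eq_right hle]
      have : (((b.n - 1 : ℕ) : ℝ)) + 1 = b.n := by
        rw [Nat.cast_sub hn]; push_cast; ring
      rw [this]; exact hun
  refine ⟨i, by omega, ?_, ?_⟩
  · push_cast
    rw [div_le_iff₀ hMcr]
    have : 2 * π * ((b.j0 : ℝ) + i) ≤ 2 * π * ((b.j0 : ℝ) + u) := by nlinarith [Real.pi_pos]
    refine this.trans ?_
    rw [hu]; field_simp; nlinarith [Real.pi_pos]
  · push_cast
    rw [le_div_iff₀ hMcr]
    have : 2 * π * ((b.j0 : ℝ) + u) ≤ 2 * π * ((b.j0 : ℝ) + i + 1) := by nlinarith [Real.pi_pos]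
    refine le_trans ?_ this
    rw [hu]; field_simp; nlinarith [Real.pi_pos]

/-- Contiguous blocks cover the range from the first start to the last end. [folklore] -/
theorem exists_block : ∀ (bs : List DKBlock) (b0 bl : DKBlock), bs.head? = some b0 → bs.getLast? = some bl →
    (∀ p ∈ bs.zip bs.tail, p.2.j0 * (p.1.Mc : ℤ) ≤ (p.1.j0 + p.1.n) * (p.2.Mc : ℤ)) →
    (∀ b ∈ bs, 1 ≤ b.Mc) → ∀ θ : ℝ, bStart b0 ≤ θ → θ ≤ bEnd bl →
      ∃ b ∈ bs, bStart b ≤ θ ∧ θ ≤ bEnd b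
  | [], b0, bl, h0, _, _, _, _, _, _ => by simp at h0
  | [b], b0, bl, h0, hl, _, _, θ, h1, h2 => by
      have e0 : b0 = b := by simp at h0; exact h0.symm
      have el : bl = b := by simp at hl; exact hl.symm
      rw [e0] at h1; rw [el] at h2
      exact ⟨b, by simp, h1, h2⟩
  | b :: b' :: rest, b0, bl, h0, hl, hchain, hMc, θ, h1, h2 => by
      have e0 : b0 = b := by simp at h0; exact h0.symm
      rw [e0] at h1
      by_cases hθ : θ ≤ bEnd b
      · exact ⟨b, by simp, h1, hθ⟩
      · rw [not_le] at hθ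
        have hlink : bStart b' ≤ bEnd b := by
          have hp := hchain (b, b') (by simp)
          have hM1 : (0 : ℝ) < b.Mc := by exact_mod_cast hMc b (by simp)
          have hM2 : (0 : ℝ) < b'.Mc := by exact_mod_cast hMc b' (by simp)
          unfold bStart bEnd
          rw [div_le_div_iff₀ hM2 hM1]
          have : (b'.j0 : ℝ) * b.Mc ≤ ((b.j0 : ℝ) + b.n) * b'.Mc := by exact_mod_cast hp
          nlinarith [Real.pi_pos]
        have hl' : (b' :: rest).getLast? = some bl := by
          rw [List.getLast?_cons_cons] at hl; exact hl
        obtain ⟨bb, hbb, hs, he⟩ := exists_block (b' :: rest) b' bl rfl hl'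
          (fun p hp ↦ hchain p (by rw [List.tail_cons, List.zip_cons_cons]; exact List.mem_cons_of_mem _ hp))
          (fun bb hbb ↦ hMc bb (List.mem_cons_of_mem _ hbb)) θ (by linarith) h2
        exact ⟨bb, List.mem_cons_of_mem _ hbb, hs, he⟩

/-- Unpacking `blocksOK`. [folklore] -/
theorem blocksOK_sound (h : c.blocksOK = true) :
    (∀ b ∈ c.blocks, 1 ≤ b.Mc ∧ 1 ≤ b.n ∧ 1 ≤ b.nin ∧ 1 ≤ b.etaDen ∧
        c.piI.hi * (b.etaDen : ℤ) ≤ (b.etaNum : ℤ) * c.S * b.Mc ∧ c.tabOK b = true) ∧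
      (∀ p ∈ c.blocks.zip c.blocks.tail, p.2.j0 * (p.1.Mc : ℤ) ≤ (p.1.j0 + p.1.n) * (p.2.Mc : ℤ)) ∧
      ∃ b0 bl, c.blocks.head? = some b0 ∧ c.blocks.getLast? = some bl ∧
        (if c.even then b0.j0 ≤ 0 else 2 * b0.j0 ≤ -(b0.Mc : ℤ)) ∧ (bl.Mc : ℤ) ≤ 2 * (bl.j0 + bl.n) := by
  unfold blocksOK at h
  simp only [Bool.and_eq_true, List.all_eq_true, decide_eq_true_eq] at h
  obtain ⟨⟨hall, hchain⟩, hends⟩ := h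
  refine ⟨fun b hb ↦ ?_, hchain, ?_⟩
  · obtain ⟨⟨⟨⟨⟨h1, h2⟩, h3⟩, h4⟩, h5⟩, h6⟩ := hall b hb
    exact ⟨h1, h2, h3, h4, h5, h6⟩
  · cases hh : c.blocks.head? with
    | none => simp [hh] at hends
    | some b0 =>
      cases hl : c.blocks.getLast? with
      | none => simp [hh, hl] at hends
      | some bl =>
        simp only [hh, hl, Bool.and_eq_true, decide_eq_true_eq] at hends
        refine ⟨b0, bl, rfl, rfl, ?_, hends.2⟩
        have h1 := hends.1
        split_ifs at h1 ⊢ with he <;> simpa using h1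

/-- `π/Mc ≤ η⁺` from the integer test, and `η⁺`'s numerator is positive. [folklore] -/
theorem eta_ge (hS : 0 < c.S) (hpi : MI.mem c.S Real.pi c.piI) {b : DKBlock} (hMc : 1 ≤ b.Mc)
    (hden : 1 ≤ b.etaDen) (h : c.piI.hi * (b.etaDen : ℤ) ≤ (b.etaNum : ℤ) * c.S * b.Mc) :
    Real.pi / b.Mc ≤ (b.etaNum : ℝ) / b.etaDen ∧ 1 ≤ b.etaNum := by
  have hSr : (0 : ℝ) < c.S := by exact_mod_cast hS
  have hMcr : (0 : ℝ) < b.Mc := by exact_mod_cast hMc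
  have hdr : (0 : ℝ) < b.etaDen := by exact_mod_cast hden
  have hpihi : Real.pi ≤ (c.piI.hi : ℝ) / c.S := le_hi hS hpi
  have hr : (c.piI.hi : ℝ) * b.etaDen ≤ (b.etaNum : ℝ) * c.S * b.Mc := by exact_mod_cast h
  have h1 : Real.pi / b.Mc ≤ (b.etaNum : ℝ) / b.etaDen := by
    rw [div_le_div_iff₀ hMcr hdr]
    rw [le_div_iff₀ hSr] at hpihi
    nlinarith
  refine ⟨h1, ?_⟩
  by_contra h0
  have : b.etaNum = 0 := by omega
  rw [this] at h1; simp at h1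
  have : 0 < Real.pi / b.Mc := by positivity
  linarith

/-- Unpacking `cellsOK`: every cell of every block passed `cellOK`. [folklore] -/
theorem cellsOK_sound (h : c.cellsOK = true) {b : DKBlock} (hb : b ∈ c.blocks) {i : ℕ} (hi : i < b.n) :
    ∃ lo loT : ℤ, c.cellLo b c.terms (c.remBlock (c.etaPow b) c.terms) (b.j0 + i) = some (lo, loT) ∧
      0 ≤ lo ∧ (periodDuty b (b.j0 + i) = true → c.mT ≤ loT) := by
  unfold cellsOK at h
  rw [List.all_eq_true] at h
  have hb' := h b hb
  unfold blockRangeOK at hb'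
  simp only [List.all_eq_true, List.mem_range] at hb'
  have hc := hb' i hi
  simp only [zero_add] at hc
  unfold cellOK at hc
  cases hcl : c.cellLo b c.terms (c.remBlock (c.etaPow b) c.terms) (b.j0 + i) with
  | none => simp [hcl] at hc
  | some p =>
    obtain ⟨lo, loT⟩ := p
    simp only [hcl, Bool.and_eq_true, decide_eq_true_eq, Bool.or_eq_true, Bool.not_eq_true'] at hc
    refine ⟨lo, loT, rfl, hc.1, fun hd ↦ ?_⟩
    rcases hc.2 with h' | h'
    · rw [hd] at h'; exact absurd h' (by decide)
    · exact h'

/-! ### The periodic part and the tail -/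

/-- Periodic terms have integer frequencies: `comm → isInt` for every computed term. [folklore] -/
theorem isInt_of_comm : ∀ t ∈ c.terms, t.comm = true → t.isInt = true := by
  intro t ht hcomm
  unfold terms at ht
  rw [List.mem_append] at ht
  rcases ht with ht | ht
  · rw [List.mem_map] at ht
    obtain ⟨atm, _, rfl⟩ := ht
    rfl
  · cases hv : c.valTerms with
    | none => simp [hv] at ht
    | some ts =>
      rw [hv, Option.getD_some] at ht
      unfold valTerms at hv
      -- every element of `ts` is some `valTerm val`
      have : ∀ (vs : List DKVal) (ts : List GTerm), (vs.map c.valTerm).mapM id = some ts → t ∈ ts →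
          ∃ val, c.valTerm val = some t := by
        intro vs
        induction vs with
        | nil => intro ts h ht; simp at h; subst h; simp at ht
        | cons v vs ih =>
            intro ts h ht
            rw [List.map_cons, List.mapM_cons] at h
            cases hvt : c.valTerm v with
            | none => simp [hvt] at h
            | some t' =>
              simp only [hvt, id, Option.pure_def, Option.bind_eq_bind, Option.bind_some] at h
              cases hrest : (vs.map c.valTerm).mapM id with
              | none => simp [hrest] at h
              | some ts' =>
                simp only [hrest, Option.bind_some, Option.some.injEq] at h
                subst h
                rcases List.mem_cons.1 ht with rfl | ht'
                · exact ⟨v, hvt⟩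
                · exact ih ts' hrest ht'
      obtain ⟨val, hval⟩ := this c.vals ts hv ht
      unfold valTerm at hval
      cases hL : MI.logNat c.S c.Kser val.p with
      | none => simp [hL] at hval
      | some L =>
      cases hX : c.chiBox val with
      | none => simp [hL, hX] at hval
      | some X =>
      cases hLn : MI.logNat c.S c.Kser val.n with
      | none => simp [hL, hX, hLn] at hval
      | some Ln =>
      simp only [hL, hX, hLn] at hval
      cases hE : logExact c.p0 val.n with
      | some e => simp only [hE, Option.some.injEq] at hval; subst hval; rfl
      | none =>
        simp only [hE] at hval
        cases hr : MI.divPos c.S (Ln.mulInt c.D) c.logp0I with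
        | none => simp [hr] at hval
        | some r => simp only [hr, Option.some.injEq] at hval; subst hval; simp at hcomm

/-- The periodic real terms have integer frequencies. [folklore] -/
theorem cList_int : ∀ (ts : List GTerm) (rts : List RTerm), List.Forall₂ (GRepr c.S c.R) ts rts →
    (∀ t ∈ ts, t.comm = true → t.isInt = true) → ∀ rt ∈ cList ts rts, ∃ k : ℤ, rt.κ = k
  | _, _, List.Forall₂.nil, _ => by simp [cList]
  | _, _, @List.Forall₂.cons _ _ _ t rt ts rts hh hF, hint => by
      intro r hr
      have hint' : ∀ s ∈ ts, s.comm = true → s.isInt = true := fun s hs ↦ hint s (by simp [hs])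
      by_cases hc : t.comm = true
      · simp only [cList, hc, if_true, List.mem_cons] at hr
        rcases hr with rfl | hr
        · exact ⟨t.k, by rw [hh.intK (hint t (by simp) hc)]; norm_cast⟩
        · exact cList_int ts rts hF hint' r hr
      · simp only [cList, hc, Bool.false_eq_true, if_false] at hr
        exact cList_int ts rts hF hint' r hr

/-- `sumVal` with integer frequencies is invariant under `θ ↦ θ + 2πk`. [folklore] -/
theorem sumVal_add_int_mul (l : List RTerm) (hl : ∀ t ∈ l, ∃ k : ℤ, t.κ = k) (θ : ℝ) (k : ℤ) :
    sumVal l (θ + k * (2 * π)) = sumVal l θ := by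
  induction l with
  | nil => simp
  | cons t l ih =>
      obtain ⟨m, hm⟩ := hl t (by simp)
      rw [sumVal_cons, sumVal_cons, ih (fun s hs ↦ hl s (by simp [hs]))]
      congr 1
      simp only [RTerm.val, hm, mul_add]
      have e : (m : ℝ) * (k * (2 * π)) = ((m * k : ℤ) : ℝ) * (2 * π) := by push_cast; ring
      rw [e, Real.cos_add_int_mul_two_pi, Real.sin_add_int_mul_two_pi]

/-- The non-periodic terms are bounded by `bInc / S`. [folklore] -/
theorem ncList_abs_le (hS : 0 < c.S) : ∀ (ts : List GTerm) (rts : List RTerm), List.Forall₂ (GRepr c.S c.R) ts rts →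
    ((ncList ts rts).map fun t ↦ |t.A| + |t.B|).sum ≤
      ((((ts.filter fun t ↦ !t.comm).map fun t ↦ t.A.absHi + t.B.absHi).sum : ℤ) : ℝ) / c.S
  | _, _, List.Forall₂.nil => by simp [ncList]
  | _, _, @List.Forall₂.cons _ _ _ t rt ts rts hh hF => by
      have ih := ncList_abs_le hS ts rts hF
      by_cases hc : t.comm = true
      · simp only [ncList, hc, if_true, List.filter_cons, Bool.not_true, Bool.false_eq_true]
        exact ih
      · have hcf : t.comm = false := Bool.eq_false_iff.2 hc
        simp only [ncList, hcf, Bool.false_eq_true, if_false, List.map_cons, List.sum_cons, List.filter_cons,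
          Bool.not_false, if_true] at ih ⊢
        rw [Int.cast_add, add_div]
        refine add_le_add ?_ ih
        rw [Int.cast_add, add_div]
        exact add_le_add (abs_le_absUp hS hh.memA) (abs_le_absUp hS hh.memB)

/-- The digamma tail bound from `psiTailLo`: for `|θ| ≥ 2π|jj|/Mc`, `v/S ≤ Re ψ(σ' + iρθ)`. [folklore] -/
theorem psiTailLo_sound (hS : 0 < c.S) (hpi : MI.mem c.S Real.pi c.piI) (hrho : MI.mem c.S c.rhoR c.rhoI)
    (hρ : 0 < c.rhoR) {Mc : ℕ} (hMc : 1 ≤ Mc) (jj : ℤ) {v : ℤ} (h : c.psiTailLo Mc jj = some v) {θ : ℝ}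
    (hθ : 2 * π * |(jj : ℝ)| / Mc ≤ |θ|) :
    (v : ℝ) / c.S ≤ (Complex.digamma ((c.sigR : ℂ) + (c.rhoR * θ : ℝ) * I)).re := by
  have hSr : (0 : ℝ) < c.S := by exact_mod_cast hS
  obtain ⟨hsig, hsig0⟩ := sigR_mem (c := c)
  unfold psiTailLo at h
  set th := (c.piI.mulInt (2 * |jj|)).divNat Mc with hth
  set y := MI.mul c.S th c.rhoI with hy
  set yt : ℤ := max 0 y.lo with hyt
  cases hDg : MC.digammaBox c.S c.Kdig c.Jdig c.piI MC.bernoulliTable ⟨c.sigI, ⟨yt, yt⟩⟩ with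
  | none => simp [← hy, ← hyt, hDg] at h
  | some Dg =>
    simp only [← hy, ← hyt, hDg, Option.some.injEq] at h
    subst h
    have hthm : MI.mem c.S (2 * π * |(jj : ℝ)| / Mc) th := by
      have := MI.mem_divNat (MI.mem_mulInt hpi (2 * |jj|)) (n := Mc) (by omega)
      rw [hth]; convert this using 1; push_cast; ring
    have hym : MI.mem c.S (2 * π * |(jj : ℝ)| / Mc * c.rhoR) y := MI.mem_mul hS hthm hrho
    have hY0 : 0 ≤ 2 * π * |(jj : ℝ)| / Mc * c.rhoR := by positivity
    have hyt0 : (0 : ℝ) ≤ (yt : ℝ) / c.S := by have : (0 : ℤ) ≤ yt := le_max_left _ _; positivity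
    have hytle : (yt : ℝ) / c.S ≤ 2 * π * |(jj : ℝ)| / Mc * c.rhoR := by
      rcases le_total 0 y.lo with h0 | h0
      · rw [hyt, max_eq_right h0]; exact lo_le hS hym
      · rw [hyt, max_eq_left h0]; simp [hY0]
    have hmono : (Complex.digamma ((c.sigR : ℂ) + (((yt : ℝ) / c.S : ℝ) : ℂ) * I)).re ≤
        (Complex.digamma ((c.sigR : ℂ) + ((c.rhoR * θ : ℝ) : ℂ) * I)).re := by
      apply re_digamma_mono hsig0
      rw [abs_of_nonneg hyt0, abs_mul, abs_of_pos hρ]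
      calc (yt : ℝ) / c.S ≤ 2 * π * |(jj : ℝ)| / Mc * c.rhoR := hytle
        _ ≤ |θ| * c.rhoR := by gcongr
        _ = c.rhoR * |θ| := mul_comm _ _
    refine le_trans ?_ hmono
    have hw : MC.mem c.S ((c.sigR : ℂ) + ((((yt : ℝ) / c.S : ℝ)) : ℂ) * I) ⟨c.sigI, ⟨yt, yt⟩⟩ := by
      refine ⟨?_, ?_⟩
      · simp only [Complex.add_re, Complex.ofReal_re, Complex.mul_re, Complex.I_re, Complex.I_im,
          Complex.ofReal_im, mul_zero, mul_one, sub_zero, add_zero]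
        exact hsig
      · simp only [Complex.add_im, Complex.ofReal_im, Complex.mul_im, Complex.I_re, Complex.I_im,
          Complex.ofReal_re, mul_zero, mul_one, zero_add, add_zero]
        exact mem_thin hS yt
    exact lo_le hS (MC.mem_digammaBox_table hS hpi hDg hw).1

end DKCert

end Summit.Ventures.WeilGRH

end
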